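import Summits.MatrixMultiplication.OmegaCensus.SmallFormats.RankOnePlaneCapGaugeV12
import HarnessLib

/-!
# ω-census family (a): the residual shear of the v1.2 gauge ('ZSPLIT') as a normal-form theorem

Cell `pub-omega` (unit `pub-omega-eng1`, gen 33), topic `Summits/MatrixMultiplication/OmegaCensus`
(sub-folder `SmallFormats`). Framing (verbatim): lottery ticket; floor = certified bounds/negative
ranges. HONEST FRAMING: bookkeeping for the two gauge-SAT encoders of the `𝔽₃` `⟨2,2,5⟩@17`
X-marginal census (tensor's kitjob-gs option `JOB_NORM3`, ENG1's x2gs option `JOB_ZSPLIT`): the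
v1.2 gauge `gauge_normal_form_v12` fixes the output planes `F′₁, F′₂ ⊆ ⟨e₀,…,e₃⟩` and the head, but
its residual group still contains the OUTPUT SHEARS `S(x) = [[I₄, 0], [x, 1]] ∈ GL₅` (row 4 =
`(x₀,x₁,x₂,x₃,1)`), which act on a computation `(f_i, g_i, W_i)` by `W_i ↦ W_i S(x)`,
`g_i ↦ g_i(· S(−x))` and therefore
* keep every X-form (`exists_colTransform`), every output row whose 5th entry vanishes (so all
  `R₁`/`R₂` outputs and the head of any `i₀ ∈ R₁`), the 5th column of every output, and the value of
  every `g_i` on matrices with vanishing 5th column (so columns `0…3` of every `G_i`, hence every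
  `θᵀG_i`-condition of the v1.2 gauge);
* can kill columns `0…3` of ONE output row with a nonzero 5th entry (`x_ν = −W[ρ][ν]/W[ρ][4]`).
Choosing that row to be the FIRST one (first term in the index order, then first row) gives the
normal form `shear_normal_form`: EITHER every output has a zero 5th column, OR there are a term `i₁`
and a row `ρ` with `W_{i₁}[ρ] = (0,0,0,0,≠0)`, all earlier terms having zero 5th column and the
earlier rows of `W_{i₁}` a zero 5th entry — for `c = 2` and `m` free terms exactly the `2m + 1`
sub-cases of the encoders' residual split. `gauge_normal_form_v12_shear` composes it with the v1.2
gauge (head taken at a term `i₀ ∈ R₁`, as both encoders do), so a census word obtained WITH the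
residual split rests on a tree theorem exactly as the v1.2 case list does. All forms are
sign-invariant, so the per-term sign rule (`exists_rescale_gw`) is applied afterwards unchanged.
Not a bound on any rank, not progress on `ω`.
-/

namespace Summit.MatrixMultiplication.OmegaCensus.RankOnePlaneCapGeneral

open Module Matrix Literature.Computability.AlgebraicComplexity

variable {k : Type*} [Field k] {c m : ℕ} {ι : Type*} [Fintype ι]

/-! ### The output shear `S(x)` -/

/-- The output shear `S(x) ∈ k^{5×5}` (rows `0…3` = `e₀…e₃`, row `4` = `(x₀,x₁,x₂,x₃,1)`) acts on a
row `w` by `w ↦ w S(x)`: coordinate `ν ≤ 3` becomes `w_ν + w₄ x_ν`, coordinate `4` stays `w₄`. -/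
theorem colShear_fin5_apply (x : Fin 5 → k) (w : Fin 5 → k) :
    let S : Matrix (Fin 5) (Fin 5) k := Matrix.of fun i j =>
      if i = 4 then (if j = 4 then 1 else x j) else (if i = j then 1 else 0)
    (∀ ν, ν ≠ 4 → (w ᵥ* S) ν = w ν + w 4 * x ν) ∧ (w ᵥ* S) 4 = w 4 := by
  intro S
  refine ⟨fun ν hν => ?_, ?_⟩
  · fin_cases ν
    · simp [S, Matrix.vecMul, dotProduct, Fin.sum_univ_five, Matrix.of_apply]
    · simp [S, Matrix.vecMul, dotProduct, Fin.sum_univ_five, Matrix.of_apply]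
    · simp [S, Matrix.vecMul, dotProduct, Fin.sum_univ_five, Matrix.of_apply]
    · simp [S, Matrix.vecMul, dotProduct, Fin.sum_univ_five, Matrix.of_apply]
    · exact absurd rfl hν
  · simp [S, Matrix.vecMul, dotProduct, Fin.sum_univ_five, Matrix.of_apply]

/-- `S(−x) S(x) = 1`, and `Y S(−x) = Y` for every `Y` with vanishing 5th column — so in
`exists_colTransform` (`A = S(−x)`, `A' = S(x)`) the new Y-forms `g_i(· S(−x))` agree with the old
ones on all matrices with zero 5th column. -/
theorem colShear_fin5_gauge (x : Fin 5 → k) :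
    let S : Matrix (Fin 5) (Fin 5) k := Matrix.of fun i j =>
      if i = 4 then (if j = 4 then 1 else x j) else (if i = j then 1 else 0)
    let S' : Matrix (Fin 5) (Fin 5) k := Matrix.of fun i j =>
      if i = 4 then (if j = 4 then 1 else -x j) else (if i = j then 1 else 0)
    S' * S = 1 ∧ ∀ Y : Matrix (Fin m) (Fin 5) k, (∀ μ, Y μ 4 = 0) → Y * S' = Y := by
  intro S S'
  refine ⟨?_, fun Y hY => ?_⟩
  · ext i j
    fin_cases i <;> fin_cases j <;>
      simp [S, S', Matrix.mul_apply, Fin.sum_univ_five, Matrix.of_apply]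
  · ext μ j
    fin_cases j <;> simp [S', Matrix.mul_apply, Fin.sum_univ_five, Matrix.of_apply, hY μ]

/-- Outputs after a column transform, any format: `(W A') κ j = (W κ) A' j`. -/
theorem mul_apply_eq_vecMul_gen (W : Matrix (Fin c) (Fin 5) k) (A' : Matrix (Fin 5) (Fin 5) k)
    (κ : Fin c) (j : Fin 5) : (W * A') κ j = (W κ ᵥ* A') j := rfl

/-- **Output shear** (an element of the residual group of the v1.2 gauge). For every
`x`, a computation `(f_i, g_i, W_i)_i` of `⟨c,m,5⟩` yields a computation `(f_i, g'_i, W'_i)_i` of the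
same map with the SAME X-forms, `g'_i = g_i` on every `Y` with vanishing 5th column (columns `0…3`
of the Y-coefficient matrices are unchanged), `W'_i[κ][ν] = W_i[κ][ν] + W_i[κ][4] x_ν` for `ν ≤ 3`
and `W'_i[κ][4] = W_i[κ][4]`. -/
theorem exists_colShear (β : BilinComp (mulBilin k c m 5) ι) (x : Fin 5 → k) :
    ∃ β' : BilinComp (mulBilin k c m 5) ι,
      (∀ i, β'.f i = β.f i) ∧
      (∀ i Y, (∀ μ, Y μ 4 = 0) → β'.g i Y = β.g i Y) ∧
      (∀ i κ ν, ν ≠ 4 → β'.w i κ ν = β.w i κ ν + β.w i κ 4 * x ν) ∧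
      (∀ i κ, β'.w i κ 4 = β.w i κ 4) := by
  obtain ⟨hSS, hY⟩ := colShear_fin5_gauge (m := m) x
  obtain ⟨β', hf, hg, hw⟩ := exists_colTransform β _ _ hSS
  refine ⟨β', hf, fun i Y hY0 => by rw [hg, hY Y hY0], fun i κ ν hν => ?_, fun i κ => ?_⟩
  · obtain ⟨h, -⟩ := colShear_fin5_apply x (β.w i κ)
    rw [hw, mul_apply_eq_vecMul_gen]
    exact h ν hν
  · obtain ⟨-, h⟩ := colShear_fin5_apply x (β.w i κ)
    rw [hw, mul_apply_eq_vecMul_gen]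
    exact h

/-- Killing an entry with the shear: `a + b · (−(a/b)) = 0` for `b ≠ 0`. -/
theorem add_mul_neg_div_eq_zero (a b : k) (hb : b ≠ 0) : a + b * -(a / b) = 0 := by
  rw [mul_neg, mul_div_cancel₀ a hb, add_neg_cancel]

/-- The `θᵀG_i`-coordinates `ν ≤ 3` of the v1.2 gauge are unchanged by a transform that keeps every
`g_i` on matrices with vanishing 5th column. -/
theorem vecMul_gMatrix_eq_of_agree {β β' : BilinComp (mulBilin k c m 5) ι}
    (hg : ∀ i Y, (∀ μ, Y μ 4 = 0) → β'.g i Y = β.g i Y) (θ : Fin m → k) (i : ι) {ν : Fin 5}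
    (hν : ν ≠ 4) :
    (θ ᵥ* Matrix.of fun μ ν => β'.g i (Matrix.single μ ν (1 : k))) ν =
      (θ ᵥ* Matrix.of fun μ ν => β.g i (Matrix.single μ ν (1 : k))) ν := by
  simp only [Matrix.vecMul, dotProduct, Matrix.of_apply]
  refine Finset.sum_congr rfl fun μ _ => ?_
  rw [hg i _ fun μ' => Matrix.single_apply_of_col_ne μ μ' hν (1 : k)]

/-! ### The shear normal form ('ZSPLIT') -/

/-- **Shear normal form** (the residual split of both gauge-SAT encoders, any field, any format
`⟨c,m,5⟩`, terms in a linear order). Every computation is moved by ONE output shear — keeping the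
X-forms, the 5th column of every output, every output row with zero 5th entry, and every `g_i` on
matrices with zero 5th column — to a computation in which EITHER every output has a vanishing 5th
column, OR for the first term `i₁` having an output row with nonzero 5th entry and its first such
row `ρ`: `W_{i₁}[ρ][ν] = 0` for `ν ≤ 3` (and `W_{i₁}[ρ][4] ≠ 0`, all terms `i < i₁` have zero 5th
column, all rows `κ < ρ` of `W_{i₁}` have zero 5th entry). -/
theorem shear_normal_form [LinearOrder ι] (β : BilinComp (mulBilin k c m 5) ι) :
    ∃ β' : BilinComp (mulBilin k c m 5) ι,
      (∀ i, β'.f i = β.f i) ∧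
      (∀ i Y, (∀ μ, Y μ 4 = 0) → β'.g i Y = β.g i Y) ∧
      (∀ i κ, β'.w i κ 4 = β.w i κ 4) ∧
      (∀ i κ, β.w i κ 4 = 0 → β'.w i κ = β.w i κ) ∧
      ((∀ i κ, β'.w i κ 4 = 0) ∨
        ∃ i₁ ρ, β'.w i₁ ρ 4 ≠ 0 ∧ (∀ ν, ν ≠ 4 → β'.w i₁ ρ ν = 0) ∧
          (∀ κ, κ < ρ → β'.w i₁ κ 4 = 0) ∧ (∀ i, i < i₁ → ∀ κ, β'.w i κ 4 = 0)) := by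
  classical
  by_cases hall : ∀ i κ, β.w i κ 4 = 0
  · exact ⟨β, fun _ => rfl, fun _ _ _ => rfl, fun _ _ => rfl, fun _ _ _ => rfl, Or.inl hall⟩
  push Not at hall
  -- the first term with a nonzero fifth column, and its first such row
  set T : Finset ι := Finset.univ.filter fun i => ∃ κ, β.w i κ 4 ≠ 0 with hTdef
  have hT : T.Nonempty := by
    obtain ⟨i, κ, h⟩ := hall
    exact ⟨i, Finset.mem_filter.mpr ⟨Finset.mem_univ _, κ, h⟩⟩
  obtain ⟨κ₀, hκ₀⟩ : ∃ κ, β.w (T.min' hT) κ 4 ≠ 0 := (Finset.mem_filter.mp (Finset.min'_mem T hT)).2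
  set K : Finset (Fin c) := Finset.univ.filter fun κ => β.w (T.min' hT) κ 4 ≠ 0 with hKdef
  have hK : K.Nonempty := ⟨κ₀, Finset.mem_filter.mpr ⟨Finset.mem_univ _, hκ₀⟩⟩
  have hpiv : β.w (T.min' hT) (K.min' hK) 4 ≠ 0 := (Finset.mem_filter.mp (Finset.min'_mem K hK)).2
  have hbefore : ∀ i, i < T.min' hT → ∀ κ, β.w i κ 4 = 0 := by
    intro i hi κ
    by_contra h
    have hiT : i ∈ T := Finset.mem_filter.mpr ⟨Finset.mem_univ _, κ, h⟩
    exact absurd hi (not_lt.mpr (Finset.min'_le T i hiT))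
  have habove : ∀ κ, κ < K.min' hK → β.w (T.min' hT) κ 4 = 0 := by
    intro κ hκ
    by_contra h
    have hκK : κ ∈ K := Finset.mem_filter.mpr ⟨Finset.mem_univ _, h⟩
    exact absurd hκ (not_lt.mpr (Finset.min'_le K κ hκK))
  -- shear killing row `ρ` of term `i₁` in columns `0…3`
  obtain ⟨β', hf, hg, hw, hw4⟩ :=
    exists_colShear β fun ν => -(β.w (T.min' hT) (K.min' hK) ν / β.w (T.min' hT) (K.min' hK) 4)
  refine ⟨β', hf, hg, hw4, fun i κ h0 => ?_, Or.inr ⟨T.min' hT, K.min' hK, ?_, fun ν hν => ?_,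
    fun κ hκ => ?_, fun i hi κ => ?_⟩⟩
  · ext ν
    by_cases hν : ν = 4
    · rw [hν, hw4]
    · rw [hw i κ ν hν, h0, zero_mul, add_zero]
  · rw [hw4]; exact hpiv
  · rw [hw _ _ ν hν]; exact add_mul_neg_div_eq_zero _ _ hpiv
  · rw [hw4]; exact habove κ hκ
  · rw [hw4]; exact hbefore i hi κ

/-! ### Composition with the v1.2 gauge (`𝔽₃`, `⟨2,2,5⟩`, 17 products) -/

/-- **The v1.2 gauge followed by the residual shear** (what a census word obtained with the
residual split cites). Hypotheses of `gauge_normal_form_v12`, with the head taken at a term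
`i₀ ∈ R₁` (as the encoders do) and the terms in a linear order. Conclusion: the full v1.2 normal form
(same X-forms; `R₁`-outputs on columns `{0,1}` with the `θ₁ᵀG_i` zeros; 'line' with the 13 Borel
heads or 'zero' with the 6 `GL₂` heads, each with its `R₂`-support and `θ₂ᵀG_i` zeros) AND the shear
normal form, spelled out for `c = 2`: either every output has zero 5th column, or there is a term
`i₁ ∉ R₁ ∪ R₂` such that every earlier term has zero 5th column and either
`W_{i₁}[0] = (0,0,0,0,≠0)`, or `W_{i₁}[0][4] = 0` and `W_{i₁}[1] = (0,0,0,0,≠0)`. -/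
theorem gauge_normal_form_v12_shear [LinearOrder ι] (h17 : Fintype.card ι = 17)
    (β : BilinComp (mulBilin (ZMod 3) 2 2 5) ι) {lam₁ lam₂ : Fin 2 → ZMod 3}
    (hlam₁ : lam₁ ≠ 0) (hlam₂ : lam₂ ≠ 0) (R₁ R₂ : Finset ι) (hdisj : Disjoint R₁ R₂)
    (hR₁ : ∀ i ∈ R₁, ∀ z : Fin 2 → ZMod 3, β.f i (vecMulVec z lam₁) = 0)
    (hR₂ : ∀ i ∈ R₂, ∀ z : Fin 2 → ZMod 3, β.f i (vecMulVec z lam₂) = 0)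
    (hc₁ : R₁.card = 4) (hc₂ : R₂.card = 4) {i₀ : ι} (hi₀ : i₀ ∈ R₁) :
    ∃ β' : BilinComp (mulBilin (ZMod 3) 2 2 5) ι,
      (∀ i, β'.f i = β.f i) ∧
      (∀ i ∈ R₁, ∀ κ, β'.w i κ 2 = 0 ∧ β'.w i κ 3 = 0 ∧ β'.w i κ 4 = 0) ∧
      (∃ θ₁ : Fin 2 → ZMod 3, θ₁ ≠ 0 ∧ θ₁ ⬝ᵥ lam₁ = 0 ∧ ∀ i, i ∉ R₁ →
        (θ₁ ᵥ* Matrix.of fun μ ν => β'.g i (Matrix.single μ ν (1 : ZMod 3))) 0 = 0 ∧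
        (θ₁ ᵥ* Matrix.of fun μ ν => β'.g i (Matrix.single μ ν (1 : ZMod 3))) 1 = 0) ∧
      (((∀ i ∈ R₂, ∀ κ, β'.w i κ 1 = 0 ∧ β'.w i κ 3 = 0 ∧ β'.w i κ 4 = 0) ∧
          (∃ θ₂ : Fin 2 → ZMod 3, θ₂ ≠ 0 ∧ θ₂ ⬝ᵥ lam₂ = 0 ∧ ∀ i, i ∉ R₂ →
            (θ₂ ᵥ* Matrix.of fun μ ν => β'.g i (Matrix.single μ ν (1 : ZMod 3))) 0 = 0 ∧
            (θ₂ ᵥ* Matrix.of fun μ ν => β'.g i (Matrix.single μ ν (1 : ZMod 3))) 2 = 0) ∧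
          !![β'.w i₀ 0 0, β'.w i₀ 0 1; β'.w i₀ 1 0, β'.w i₀ 1 1] ∈
            ([!![0, 0; 0, 0], !![0, 0; 1, 0], !![0, 0; 0, 1], !![1, 0; 0, 0], !![1, 0; 1, 0],
              !![1, 0; 2, 0], !![0, 1; 0, 0], !![0, 1; 0, 1], !![0, 1; 0, 2], !![1, 0; 0, 1],
              !![0, 1; 1, 0], !![0, 1; 1, 1], !![0, 1; 1, 2]] :
              List (Matrix (Fin 2) (Fin 2) (ZMod 3)))) ∨
       ((∀ i ∈ R₂, ∀ κ, β'.w i κ 0 = 0 ∧ β'.w i κ 1 = 0 ∧ β'.w i κ 4 = 0) ∧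
          (∃ θ₂ : Fin 2 → ZMod 3, θ₂ ≠ 0 ∧ θ₂ ⬝ᵥ lam₂ = 0 ∧ ∀ i, i ∉ R₂ →
            (θ₂ ᵥ* Matrix.of fun μ ν => β'.g i (Matrix.single μ ν (1 : ZMod 3))) 2 = 0 ∧
            (θ₂ ᵥ* Matrix.of fun μ ν => β'.g i (Matrix.single μ ν (1 : ZMod 3))) 3 = 0) ∧
          !![β'.w i₀ 0 0, β'.w i₀ 0 1; β'.w i₀ 1 0, β'.w i₀ 1 1] ∈
            ([!![0, 0; 0, 0], !![1, 0; 0, 0], !![1, 0; 1, 0], !![1, 0; 2, 0], !![0, 0; 1, 0],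
              !![1, 0; 0, 1]] : List (Matrix (Fin 2) (Fin 2) (ZMod 3))))) ∧
      ((∀ i κ, β'.w i κ 4 = 0) ∨
        ∃ i₁, i₁ ∉ R₁ ∧ i₁ ∉ R₂ ∧ (∀ i, i < i₁ → ∀ κ, β'.w i κ 4 = 0) ∧
          ((β'.w i₁ 0 4 ≠ 0 ∧ β'.w i₁ 0 0 = 0 ∧ β'.w i₁ 0 1 = 0 ∧ β'.w i₁ 0 2 = 0 ∧
              β'.w i₁ 0 3 = 0) ∨
           (β'.w i₁ 0 4 = 0 ∧ β'.w i₁ 1 4 ≠ 0 ∧ β'.w i₁ 1 0 = 0 ∧ β'.w i₁ 1 1 = 0 ∧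
              β'.w i₁ 1 2 = 0 ∧ β'.w i₁ 1 3 = 0))) := by
  classical
  obtain ⟨β₁, hf₁, hs₁, ⟨θ₁, hθ₁, hθ₁lam, hG₁⟩, hpos⟩ :=
    gauge_normal_form_v12 h17 β hlam₁ hlam₂ R₁ R₂ hdisj hR₁ hR₂ hc₁ hc₂ i₀
  obtain ⟨β₂, hf₂, hg₂, hw4, hrow, hnf⟩ := shear_normal_form β₁
  -- rows with zero 5th entry are untouched: all `R₁`-outputs (both positions), all `R₂`-outputs
  have hR₁row : ∀ i ∈ R₁, ∀ κ, β₂.w i κ = β₁.w i κ := fun i hi κ => hrow i κ (hs₁ i hi κ).2.2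
  have hf : ∀ i, β₂.f i = β.f i := fun i => by rw [hf₂, hf₁]
  have hs₂ : ∀ i ∈ R₁, ∀ κ, β₂.w i κ 2 = 0 ∧ β₂.w i κ 3 = 0 ∧ β₂.w i κ 4 = 0 := fun i hi κ => by
    rw [hR₁row i hi κ]; exact hs₁ i hi κ
  have hhead : !![β₂.w i₀ 0 0, β₂.w i₀ 0 1; β₂.w i₀ 1 0, β₂.w i₀ 1 1] =
      !![β₁.w i₀ 0 0, β₁.w i₀ 0 1; β₁.w i₀ 1 0, β₁.w i₀ 1 1] := by
    rw [hR₁row i₀ hi₀ 0, hR₁row i₀ hi₀ 1]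
  have hG : ∀ (θ : Fin 2 → ZMod 3) (i : ι) {ν : Fin 5}, ν ≠ 4 →
      (θ ᵥ* Matrix.of fun μ ν => β₂.g i (Matrix.single μ ν (1 : ZMod 3))) ν =
        (θ ᵥ* Matrix.of fun μ ν => β₁.g i (Matrix.single μ ν (1 : ZMod 3))) ν :=
    fun θ i ν hν => vecMul_gMatrix_eq_of_agree hg₂ θ i hν
  -- the shear normal form, read for `c = 2`
  have hnf' : (∀ i κ, β₂.w i κ 4 = 0) ∨
      ∃ i₁, i₁ ∉ R₁ ∧ i₁ ∉ R₂ ∧ (∀ i, i < i₁ → ∀ κ, β₂.w i κ 4 = 0) ∧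
        ((β₂.w i₁ 0 4 ≠ 0 ∧ β₂.w i₁ 0 0 = 0 ∧ β₂.w i₁ 0 1 = 0 ∧ β₂.w i₁ 0 2 = 0 ∧
            β₂.w i₁ 0 3 = 0) ∨
         (β₂.w i₁ 0 4 = 0 ∧ β₂.w i₁ 1 4 ≠ 0 ∧ β₂.w i₁ 1 0 = 0 ∧ β₂.w i₁ 1 1 = 0 ∧
            β₂.w i₁ 1 2 = 0 ∧ β₂.w i₁ 1 3 = 0)) := by
    rcases hnf with hall | ⟨i₁, ρ, hpiv, hzero, habove, hbefore⟩
    · exact Or.inl hall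
    · -- `i₁` is a free term: `R₁`/`R₂` outputs have zero 5th column in both positions
      have hR₂4 : ∀ i ∈ R₂, ∀ κ, β₁.w i κ 4 = 0 := fun i hi κ => by
        rcases hpos with ⟨hl, -, -⟩ | ⟨hz, -, -⟩
        · exact (hl i hi κ).2.2
        · exact (hz i hi κ).2.2
      have hn₁ : i₁ ∉ R₁ := fun h => hpiv (by rw [hw4]; exact (hs₁ i₁ h ρ).2.2)
      have hn₂ : i₁ ∉ R₂ := fun h => hpiv (by rw [hw4]; exact hR₂4 i₁ h ρ)
      refine Or.inr ⟨i₁, hn₁, hn₂, hbefore, ?_⟩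
      fin_cases ρ
      · exact Or.inl ⟨hpiv, hzero 0 (by decide), hzero 1 (by decide), hzero 2 (by decide),
          hzero 3 (by decide)⟩
      · exact Or.inr ⟨habove 0 (by decide), hpiv, hzero 0 (by decide), hzero 1 (by decide),
          hzero 2 (by decide), hzero 3 (by decide)⟩
  refine ⟨β₂, hf, hs₂, ⟨θ₁, hθ₁, hθ₁lam, fun i hi => ?_⟩, ?_, hnf'⟩
  · rw [hG θ₁ i (by decide), hG θ₁ i (by decide)]; exact hG₁ i hi
  rcases hpos with ⟨hl, ⟨θ₂, hθ₂, hθ₂lam, hG₂⟩, hmem⟩ | ⟨hz, ⟨θ₂, hθ₂, hθ₂lam, hG₂⟩, hmem⟩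
  · refine Or.inl ⟨fun i hi κ => ?_, ⟨θ₂, hθ₂, hθ₂lam, fun i hi => ?_⟩, by rw [hhead]; exact hmem⟩
    · rw [hrow i κ (hl i hi κ).2.2]; exact hl i hi κ
    · rw [hG θ₂ i (by decide), hG θ₂ i (by decide)]; exact hG₂ i hi
  · refine Or.inr ⟨fun i hi κ => ?_, ⟨θ₂, hθ₂, hθ₂lam, fun i hi => ?_⟩, by rw [hhead]; exact hmem⟩
    · rw [hrow i κ (hz i hi κ).2.2]; exact hz i hi κ
    · rw [hG θ₂ i (by decide), hG θ₂ i (by decide)]; exact hG₂ i hi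

end Summit.MatrixMultiplication.OmegaCensus.RankOnePlaneCapGeneral
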